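import Summits.Langlands.Langlands.Theses.ThreeTorsionCollapse
import Literature.NumberTheory.Automorphic.TotallyRealModularityX0Fifteen
import Literature.NumberTheory.GaloisRepresentations.OrdinaryGaloisRep

/-!
# Sketch — first lemmas of the crux ideas (crux-ideate r1 k2) for `SplitCartanThreeAutomorphic`
# (stmt-Langlands-18556), route `Langlands/ThreeTorsionCollapse`.

Three first lemmas, one per idea card, typed over the vocabulary of `Lines/threelocal.lean`
(Tate frame `ρ₃ : FramedGaloisRep K (PadicAlgCl 3) 2`, `IsOrdinaryOfWeightAt`, `IsTorsionGaloisRep`,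
`HasIrreducibleModPGaloisRep`, `IsAutomorphicOfWeightZero`).  They are NOT proved here (ideation
stage: `sorry`), they must only elaborate.

* `flaggedSW_nearlyOrdinaryCell` (card `flagged-skinner-wiles-at-three`): type (I) + nearly ordinary
  of weight 2 at EVERY `w ∣ 3` ⇒ automorphic — NO distinguishedness (`ζ₃ ∉ K_w`) hypothesis: the
  union of `stub_skinnerWilesDoor` and OPEN CORE A of `threelocal`, to be proved uniformly by the
  flagged (Geraghty–Allen) nearly ordinary Skinner–Wiles argument at `p = 3`.
* `pOrdinaryHybrid_mixedCell` (card `p-ordinary-pan-hybrid`): type (I) + at every `w ∣ 3` EITHER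
  nearly ordinary of weight 2 OR (`K_w = ℚ₃`, i.e. `e_w = f_w = 1`, and `ρ₃|_{D_w}` irreducible)
  ⇒ automorphic: the place-by-place hybrid of Hida theory (at the ordinary places) and
  Pan–Zhang `p`-adic local Langlands for `GL₂(ℚ₃)` (at the others).
* `twoAdicDoor_cell` (card `two-adic-door`): Allen's 2-adic corollary (Allen 2014, Cor. p. 4 of
  arXiv:1301.1113) restricted to the cell: potentially multiplicative above 2 (`v(j_E) ≤ 0`, typed
  as `v(Δ) ≥ v(c₄³)` additively, i.e. `val Δ ≤ val c₄³` multiplicatively), no `K`-rational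
  2-torsion, `Δ` not a square in `K`, and (if `Δ` is totally negative) `Δ` a non-square in some
  `K_v`, `v ∣ 2` ⇒ automorphic.
-/

namespace Summit.Langlands.Langlands.Cruxes.SplitCartanThreeAutomorphic.IdeasR1K2

open scoped NumberField MatrixGroups Polynomial
open NumberField IsDedekindDomain Filter
open Literature.NumberTheory.Automorphic Literature.NumberTheory.GaloisRepresentations
open Summit.Langlands.Langlands.Theses.ThreeTorsionCollapse

/-- FIRST LEMMA of card `flagged-skinner-wiles-at-three`: on the `N_s(3)` cell with `E[3]`
irreducible, near-ordinarity of weight 2 at every place above 3 ALONE implies automorphy (no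
`D_w`-distinguishedness).  Union of `threelocal.stub_skinnerWilesDoor` and OPEN CORE A. -/
theorem flaggedSW_nearlyOrdinaryCell :
    ∀ (K : Type) [Field K] [NumberField K] [IsTotallyReal K] (E : WeierstrassCurve (𝓞 K)),
      E.Δ ≠ 0 → ∀ ρ : FramedGaloisRep K (ZMod 3) 2, (E.baseChange K).IsTorsionGaloisRep 3 ρ →
        (∀ σ : Field.absoluteGaloisGroup K, (ρ σ : GL (Fin 2) (ZMod 3)) ∈
          Subgroup.closure ({(⟨!![1, 0; 0, 2], !![1, 0; 0, 2], by decide, by decide⟩ :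
              GL (Fin 2) (ZMod 3)),
            (⟨!![0, 1; 1, 0], !![0, 1; 1, 0], by decide, by decide⟩ : GL (Fin 2) (ZMod 3))} :
            Set (GL (Fin 2) (ZMod 3)))) →
        (E.baseChange K).HasIrreducibleModPGaloisRep 3 →
        (∃ ρ₃ : FramedGaloisRep K (PadicAlgCl 3) 2,
          (ρ₃.toGaloisRep.IsIrreducible ∧
            ∀ᶠ w : HeightOneSpectrum (𝓞 K) in cofinite, ρ₃.IsUnramifiedAt w ∧
              ρ₃.HasFrobCharpolyAt w (Polynomial.X ^ 2 -
                Polynomial.C ((frobTraceAt E w : ℤ) : PadicAlgCl 3) * Polynomial.X +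
                Polynomial.C ((w.residueCard : ℕ) : PadicAlgCl 3))) ∧
            ∀ w : HeightOneSpectrum (𝓞 K), (3 : 𝓞 K) ∈ w.asIdeal →
              ∃ m : ℕ, 0 < m ∧ ρ₃.IsOrdinaryOfWeightAt 3 w 2 m) →
        IsAutomorphicOfWeightZero E := by
  sorry

/-- FIRST LEMMA of card `p-ordinary-pan-hybrid`: on the `N_s(3)` cell with `E[3]` irreducible,
if at EVERY `w ∣ 3` the Tate frame is either nearly ordinary of weight 2 or (`K_w = ℚ₃` and
locally irreducible), then `E` is automorphic.  `K_w = ℚ₃` is typed as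
`e(w | 3) = 1 ∧ #k(w) = 3` (`w.asIdeal.ramificationIdx ℤ = 1 ∧ w.residueCard = 3`). -/
theorem pOrdinaryHybrid_mixedCell :
    ∀ (K : Type) [Field K] [NumberField K] [IsTotallyReal K] (E : WeierstrassCurve (𝓞 K)),
      E.Δ ≠ 0 → ∀ ρ : FramedGaloisRep K (ZMod 3) 2, (E.baseChange K).IsTorsionGaloisRep 3 ρ →
        (∀ σ : Field.absoluteGaloisGroup K, (ρ σ : GL (Fin 2) (ZMod 3)) ∈
          Subgroup.closure ({(⟨!![1, 0; 0, 2], !![1, 0; 0, 2], by decide, by decide⟩ :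
              GL (Fin 2) (ZMod 3)),
            (⟨!![0, 1; 1, 0], !![0, 1; 1, 0], by decide, by decide⟩ : GL (Fin 2) (ZMod 3))} :
            Set (GL (Fin 2) (ZMod 3)))) →
        (E.baseChange K).HasIrreducibleModPGaloisRep 3 →
        (∃ ρ₃ : FramedGaloisRep K (PadicAlgCl 3) 2,
          (ρ₃.toGaloisRep.IsIrreducible ∧
            ∀ᶠ w : HeightOneSpectrum (𝓞 K) in cofinite, ρ₃.IsUnramifiedAt w ∧
              ρ₃.HasFrobCharpolyAt w (Polynomial.X ^ 2 -
                Polynomial.C ((frobTraceAt E w : ℤ) : PadicAlgCl 3) * Polynomial.X +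
                Polynomial.C ((w.residueCard : ℕ) : PadicAlgCl 3))) ∧
            ∀ w : HeightOneSpectrum (𝓞 K), (3 : 𝓞 K) ∈ w.asIdeal →
              ((∃ m : ℕ, 0 < m ∧ ρ₃.IsOrdinaryOfWeightAt 3 w 2 m) ∨
                (w.asIdeal.ramificationIdx ℤ = 1 ∧
                  w.residueCard = 3 ∧ FramedRep.IsIrreducible (ρ₃.toLocal w)))) →
        IsAutomorphicOfWeightZero E := by
  sorry

/-- FIRST LEMMA of card `two-adic-door`: Allen 2014 (arXiv:1301.1113, Corollary on p. 4) for the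
curves of the cell — modularity from the prime 2, independent of the 3-adic shape.  Hypotheses:
(i) `v(j_E) ≤ 0` at every `v ∣ 2`, typed `val_v(Δ) ≤ val_v(c₄³)` (multiplicative valuations);
(ii) no `K`-rational point of exact order 2 (the 2-division cubic `4x³ + b₂x² + 2b₄x + b₆` has no
root in `K`) and `Δ` not a square in `K` (so `ρ̄_{E,2}` has image `GL₂(𝔽₂) ≅ S₃`); (iii) if `Δ` is negative at every real place then `Δ` is a non-square in some
`K_v`, `v ∣ 2`. -/
theorem twoAdicDoor_cell :
    ∀ (K : Type) [Field K] [NumberField K] [IsTotallyReal K] (E : WeierstrassCurve (𝓞 K)),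
      E.Δ ≠ 0 →
        (∀ v : HeightOneSpectrum (𝓞 K), (2 : 𝓞 K) ∈ v.asIdeal →
          v.valuation K (algebraMap (𝓞 K) K E.Δ) ≤ v.valuation K (algebraMap (𝓞 K) K (E.c₄ ^ 3))) →
        (∀ x : K, (E.baseChange K).twoTorsionPolynomial.toPoly.eval x ≠ 0) →
        ¬ IsSquare (algebraMap (𝓞 K) K E.Δ) →
        ((∀ φ : K →+* ℝ, φ (algebraMap (𝓞 K) K E.Δ) < 0) →
          ∃ v : HeightOneSpectrum (𝓞 K), (2 : 𝓞 K) ∈ v.asIdeal ∧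
            ¬ IsSquare (algebraMap K (v.adicCompletion K) (algebraMap (𝓞 K) K E.Δ))) →
        IsAutomorphicOfWeightZero E := by
  sorry

end Summit.Langlands.Langlands.Cruxes.SplitCartanThreeAutomorphic.IdeasR1K2
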